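import Mathlib
import HarnessLib
import Literature.NumberTheory.LFunctions.RiemannXiFourier

/-!
# Riemann's kernel is Connes' transported pole-killed Hermite seed: `x^{1/2} Σ_{n≥1} h(nx) = 2(2π)^{1/4} Ψ(u)`, `x = √(2π) e^{u/2}`

Helper file (`--supports stmt-RiemannHypothesis-0098`), elementary algebra on the tree's `LagariasMontague.Psi`, no
definitions.  Seat rh-explicit-weil-5 gen15 (file of record `HOME/rh-explicit-weil-5/WEIL5-KAPPA.md` §1; companion of
`Theorems/WeilRiemannKernelNormSq.lean` and `Theorems/WeilHermiteSeedMellin.lean`).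

Context (documentation only).  The even class seed of the compressed Weil form tends, as `c → ∞`, to the pole-killed Hermite
combination `h_e(y) = κ_e·y²(y² − 3)e^{−y²/2} = h₄ − √(3/8)h₀` (`κ_e = 2/(√6π^{1/4})`; Connes–Consani–Moscovici's `h`), and
Connes' map is `𝓔h(x) = x^{1/2}Σ_{n≥1}h(nx)`.  This file proves the DICTIONARY with Riemann's kernel
`Ψ(u) = Σ_{n≥1}(2π²n⁴e^{2u} − 3πn²eᵘ)e^{u/4 − πn²eᵘ}` of the tree (`LagariasMontague.Psi`, whose Fourier transform is
`ξ(1/2 + it)` by `riemannXi_criticalLine_eq_fourier`): in the coordinate `x = √(2π)e^{u/2}` one has `x^{1/2} = (2π)^{1/4}e^{u/4}`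
and, TERM BY TERM, `x^{1/2}·h(nx)/κ_e = 2(2π)^{1/4}·[(2a²e^{2u} − 3aeᵘ)e^{u/4 − aeᵘ}]`, `a = πn²`; hence
`x^{1/2}Σ_{n≥1} y_n²(y_n² − 3)e^{−y_n²/2} = 2(2π)^{1/4}Ψ(u)` (`y_n = nx`).  With `WeilRiemannKernelNormSq`
(`∫_ℝ|ξ(1/2+it)|² = 4π∫_ℝΨ²`) this is the transport Gram constant `‖𝓔h_e‖²_{L²(dx/x)} = (κ_e²/√(2π))∫_ℝΞ²` of WEIL5-KAPPA §1.

* `sqrt_transportCoord`       : `√(√(2π)e^{u/2}) = (2π)^{1/4}e^{u/4}`;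
* `transportCoord_sq_mul`     : `((n+1)·√(2π)e^{u/2})² = 2·a_n·eᵘ` (`a_n = π(n+1)² = thetaWeight n`);
* `hermiteSeed_term_eq`       : the termwise dictionary;
* `hermiteSeed_transport_eq_Psi` : `(2π)^{1/4}e^{u/4}·Σ' n, y_n²(y_n²−3)e^{−y_n²/2} = 2(2π)^{1/4}Ψ(u)`.

Standard axioms only; no `sorry`.
-/

set_option linter.dupNamespace false
set_option autoImplicit false

noncomputable section

open Real

namespace Summit.RiemannHypothesis.RiemannHypothesis.Theorems.WeilHermiteSeedRiemannKernel

open Literature.NumberTheory.LFunctions.LagariasMontague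

/-- `√(√(2π)·e^{u/2}) = (2π)^{1/4}·e^{u/4}`: the factor `x^{1/2}` of Connes' map in the coordinate `x = √(2π)e^{u/2}`. -/
theorem sqrt_transportCoord (u : ℝ) :
    Real.sqrt (Real.sqrt (2 * π) * Real.exp (u / 2)) = (2 * π) ^ ((1 : ℝ) / 4) * Real.exp (u / 4) := by
  have h2pi : (0 : ℝ) ≤ 2 * π := by positivity
  rw [Real.sqrt_mul (Real.sqrt_nonneg _)]
  congr 1
  · rw [Real.sqrt_eq_rpow, Real.sqrt_eq_rpow, ← Real.rpow_mul h2pi]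
    norm_num
  · have : Real.exp (u / 2) = Real.exp (u / 4) ^ 2 := by
      rw [sq, ← Real.exp_add]; congr 1; ring
    rw [this, Real.sqrt_sq (Real.exp_pos _).le]

/-- `((n+1)·x)² = 2·a_n·eᵘ` for `x = √(2π)e^{u/2}`, `a_n = π(n+1)²`. -/
theorem transportCoord_sq_mul (n : ℕ) (u : ℝ) :
    (((n : ℝ) + 1) * (Real.sqrt (2 * π) * Real.exp (u / 2))) ^ 2 = 2 * thetaWeight n * Real.exp u := by
  have h2pi : (0 : ℝ) ≤ 2 * π := by positivity
  have hsq : Real.sqrt (2 * π) ^ 2 = 2 * π := Real.sq_sqrt h2pi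
  have hexp : Real.exp (u / 2) ^ 2 = Real.exp u := by
    rw [sq, ← Real.exp_add]; congr 1; ring
  unfold thetaWeight
  calc (((n : ℝ) + 1) * (Real.sqrt (2 * π) * Real.exp (u / 2))) ^ 2
      = ((n : ℝ) + 1) ^ 2 * Real.sqrt (2 * π) ^ 2 * Real.exp (u / 2) ^ 2 := by ring
    _ = 2 * (π * ((n : ℝ) + 1) ^ 2) * Real.exp u := by rw [hsq, hexp]; ring

/-- **Termwise dictionary.**  With `x = √(2π)e^{u/2}`, `y = (n+1)x`:
`(2π)^{1/4}e^{u/4} · y²(y² − 3)e^{−y²/2} = 2(2π)^{1/4} · (2a_n²e^{2u} − 3a_neᵘ)e^{u/4 − a_neᵘ}` (`= 2(2π)^{1/4}·thetaTerm psiPoly n u`). -/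
theorem hermiteSeed_term_eq (n : ℕ) (u : ℝ) :
    (2 * π) ^ ((1 : ℝ) / 4) * Real.exp (u / 4) *
        ((((n : ℝ) + 1) * (Real.sqrt (2 * π) * Real.exp (u / 2))) ^ 2 *
          ((((n : ℝ) + 1) * (Real.sqrt (2 * π) * Real.exp (u / 2))) ^ 2 - 3) *
          Real.exp (-(((n : ℝ) + 1) * (Real.sqrt (2 * π) * Real.exp (u / 2))) ^ 2 / 2)) =
      2 * (2 * π) ^ ((1 : ℝ) / 4) * thetaTerm psiPoly n u := by
  rw [transportCoord_sq_mul, thetaTerm, eval_psiPoly, Real.exp_sub]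
  have h : Real.exp (-(2 * thetaWeight n * Real.exp u) / 2) = Real.exp (-(thetaWeight n * Real.exp u)) := by
    congr 1; ring
  rw [h, Real.exp_neg]
  have hpos : Real.exp (thetaWeight n * Real.exp u) ≠ 0 := (Real.exp_pos _).ne'
  field_simp

/-- **Riemann's kernel is the transported Hermite seed**: with `x = √(2π)e^{u/2}` and `y_n = (n+1)x`,
`x^{1/2}·Σ_{n≥0} y_n²(y_n² − 3)e^{−y_n²/2} = 2(2π)^{1/4}·Ψ(u)` — so `𝓔h_e(x) = 2κ_e(2π)^{1/4}Ψ(u)` for the CCM seed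
`h_e = κ_e y²(y²−3)e^{−y²/2}`, and `Ξ(t) = ξ(1/2+it) = 𝓕Ψ(t/4π)` is (a multiple of) the transform of `𝓔h_e` (Connes 2026,
Fact 6.2). -/
theorem hermiteSeed_transport_eq_Psi (u : ℝ) :
    (2 * π) ^ ((1 : ℝ) / 4) * Real.exp (u / 4) *
        (∑' n : ℕ, (((n : ℝ) + 1) * (Real.sqrt (2 * π) * Real.exp (u / 2))) ^ 2 *
          ((((n : ℝ) + 1) * (Real.sqrt (2 * π) * Real.exp (u / 2))) ^ 2 - 3) *
          Real.exp (-(((n : ℝ) + 1) * (Real.sqrt (2 * π) * Real.exp (u / 2))) ^ 2 / 2)) =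
      2 * (2 * π) ^ ((1 : ℝ) / 4) * Psi u := by
  rw [← tsum_mul_left, Psi, thetaSeries]
  rw [show (2 * (2 * π) ^ ((1 : ℝ) / 4) * ∑' n : ℕ, thetaTerm psiPoly n u) =
      ∑' n : ℕ, 2 * (2 * π) ^ ((1 : ℝ) / 4) * thetaTerm psiPoly n u from (tsum_mul_left).symm]
  exact tsum_congr (fun n => hermiteSeed_term_eq n u)

end Summit.RiemannHypothesis.RiemannHypothesis.Theorems.WeilHermiteSeedRiemannKernel

end
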